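import Summits.Ventures.HodgeRepro.Night1ProductWeilHodge

/-!
# The Galois-invariant Weil classes: the `G`-fixed vectors of the Weil space under the regular
representation form the line of `Σ_σ e_σ = ratWeil 1`

Blind re-derivation cell `pub-hodge-repro`, seat `night-1` (gen 5, thirteenth file).  Imports night-1's
`Night1ProductWeilHodge` (the coefficient calculus `eq_sum_lineDual_smul` / `lineDual_sum_smul_weilWedgeProd`)
and, through it, `Night1ProductWeilSpace` (the Galois action `galProd k g` on `⋀^{2k} ℂ^{ι × G}`, which
carries the `σ`-line to the `gσ`-line: `galProd_weilWedgeProd`) and `Night1ProductWeilRational`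
(`ratWeil_one : ratWeil 1 = Σ_g e_g`).

The Galois group permutes the `|G|` lines of the Weil space simply transitively (gen 4: the regular
representation).  Its fixed vectors are therefore one-dimensional:

* `lineDual_galProd` — the `τ`-coefficient of `galProd g ω` is the `g⁻¹τ`-coefficient of `ω` (`k ≥ 1`);
* **`galProd_eq_self_iff`** — `ω` in the Weil space is fixed by every `galProd g` iff all its line
  coefficients agree, i.e. `ω = a • Σ_σ e_σ`;
* `galProd_ratWeil_one` / **`invariants_eq_span_ratWeil_one`** — for a Galois CM field the fixed line is
  spanned by the rational Weil class of `1 ∈ K`, `ratWeil 1 = Σ_g e_g`.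

Reading (paper-level, NIGHT1.md §12): the `G`-action here is the model's action on the CM-algebra side
(`K ⊗ ℂ = ∏_σ ℂ`, permuting the factors — a change of base embedding), so its invariants are the
`K`-trace direction of `W_K(B)`, not the `Aut(ℂ)`-invariants that cut out the `ℚ`-structure.  Nothing
geometric is built; nothing here says anything about the status of the Hodge conjecture for CM abelian
varieties, which is NOT proved.
-/

set_option autoImplicit false

open Finset Module

namespace HodgeRepro.RouteC

open CMHodgeOn

section Invariant

variable {G : Type*} [Group G] [DecidableEq G] [Fintype G] {ι : Type*} [Fintype ι] [DecidableEq ι]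

omit [Fintype ι] in
/-- `galProd g` on a combination of lines: the `σ`-line goes to the `gσ`-line. -/
theorem galProd_sum_smul_weilWedgeProd {k : ℕ} (g : G) (e : Fin (2 * k) ≃ ι) (a : G → ℂ) :
    galProd k g (∑ σ, a σ • weilWedgeProd e σ) = ∑ τ, a (g⁻¹ * τ) • weilWedgeProd e τ := by
  simp only [map_sum, map_smul, galProd_weilWedgeProd]
  exact Fintype.sum_equiv (Equiv.mulLeft g) _ _ fun σ => by simp

omit [Fintype ι] in
/-- **The Galois action is a permutation of the coefficients**: on the Weil space the `τ`-coefficient of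
`galProd g ω` is the `g⁻¹τ`-coefficient of `ω` (`k ≥ 1`). -/
theorem lineDual_galProd {k : ℕ} (hk : 0 < k) (e : Fin (2 * k) ≃ ι) (g : G)
    {ω : ⋀[ℂ]^(2 * k) ((ι × G) → ℂ)} (hω : ω ∈ weilSpaceProd G k e) (τ : G) :
    lineDual e τ (galProd k g ω) = lineDual e (g⁻¹ * τ) ω := by
  conv_lhs => rw [eq_sum_lineDual_smul hk e hω, galProd_sum_smul_weilWedgeProd,
    lineDual_sum_smul_weilWedgeProd hk e _ τ]

omit [Fintype ι] in
/-- **The Galois-fixed vectors of the Weil space are the multiples of `Σ_σ e_σ`** (`k ≥ 1`): `G` permutes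
the lines transitively, so a fixed vector has all its line coefficients equal. -/
theorem galProd_eq_self_iff {k : ℕ} (hk : 0 < k) (e : Fin (2 * k) ≃ ι)
    {ω : ⋀[ℂ]^(2 * k) ((ι × G) → ℂ)} (hω : ω ∈ weilSpaceProd G k e) :
    (∀ g : G, galProd k g ω = ω) ↔ ∃ a : ℂ, ω = a • ∑ σ, weilWedgeProd e σ := by
  constructor
  · intro h
    refine ⟨lineDual e 1 ω, ?_⟩
    have hconst : ∀ τ : G, lineDual e τ ω = lineDual e 1 ω := by
      intro τ
      have := congrArg (lineDual e τ) (h τ)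
      rw [lineDual_galProd hk e τ hω τ, inv_mul_cancel] at this
      exact this.symm
    conv_lhs => rw [eq_sum_lineDual_smul hk e hω]
    rw [Finset.smul_sum]
    exact Finset.sum_congr rfl fun τ _ => by rw [hconst τ]
  · rintro ⟨a, rfl⟩ g
    rw [map_smul, map_sum]
    congr 1
    simp only [galProd_weilWedgeProd]
    exact Fintype.sum_equiv (Equiv.mulLeft g) _ _ fun σ => rfl

end Invariant

/-! ### The rational level: the fixed line is `ratWeil 1` -/

section Rational

open CMHodge
open scoped Classical

variable (K : Type*) [Field K] [NumberField K] [IsGalois ℚ K] (φ₀ : K →+* ℂ)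
variable {ι : Type*} [Fintype ι] [DecidableEq ι]

omit [IsGalois ℚ K] [Fintype ι] in
/-- The rational Weil class of `1` is Galois-invariant. -/
theorem galProd_ratWeil_one {k : ℕ} (e : Fin (2 * k) ≃ ι) (g : K ≃ₐ[ℚ] K) :
    galProd k g (ratWeil K φ₀ e 1) = ratWeil K φ₀ e 1 := by
  rw [ratWeil_one, map_sum]
  simp only [galProd_weilWedgeProd]
  exact Fintype.sum_equiv (Equiv.mulLeft g) _ _ fun σ => rfl

omit [IsGalois ℚ K] [Fintype ι] in
/-- **The Galois invariants of the Weil space are the line of `ratWeil 1 = Σ_g e_g`** (`k ≥ 1`). -/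
theorem invariants_eq_span_ratWeil_one {k : ℕ} (hk : 0 < k) (e : Fin (2 * k) ≃ ι) :
    {ω : ⋀[ℂ]^(2 * k) ((ι × (K ≃ₐ[ℚ] K)) → ℂ) |
        ω ∈ weilSpaceProd (K ≃ₐ[ℚ] K) k e ∧ ∀ g : K ≃ₐ[ℚ] K, galProd k g ω = ω} =
      ↑(Submodule.span ℂ {ratWeil K φ₀ e 1}) := by
  ext ω
  simp only [Set.mem_setOf_eq, SetLike.mem_coe, Submodule.mem_span_singleton, ratWeil_one]
  constructor
  · rintro ⟨hω, h⟩
    obtain ⟨a, ha⟩ := (galProd_eq_self_iff hk e hω).1 h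
    exact ⟨a, ha.symm⟩
  · rintro ⟨a, rfl⟩
    have hmem : (∑ σ : K ≃ₐ[ℚ] K, weilWedgeProd e σ) ∈ weilSpaceProd (K ≃ₐ[ℚ] K) k e :=
      Submodule.sum_mem _ fun σ _ => weilWedgeProd_mem_weilSpaceProd k e σ
    refine ⟨Submodule.smul_mem _ _ hmem, ?_⟩
    exact (galProd_eq_self_iff hk e (Submodule.smul_mem _ _ hmem)).2 ⟨a, rfl⟩

end Rational

end HodgeRepro.RouteC
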